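import Literature.Computability.AlgebraicComplexity.BI17FundamentalInvariantTensors
import Literature.Computability.AlgebraicComplexity.QuantumFunctionalsDegenerationProofs
import HarnessLib

/-!
# The generic fundamental invariant `F_n` of `⊗³ℂ^{n²}` is an `SL³`-semi-invariant of weight
# `(det g₁ det g₂ det g₃)^n` (Bürgisser–Ikenmeyer 2017, Thm. 5.13, first sentence) — PROOFS

P. Bürgisser, C. Ikenmeyer, *Fundamental invariants of orbit closures*, J. Algebra **477** (2017)
390–434 = arXiv:1511.02927 [BurgisserIkenmeyer2017], §5.1, eq. (5.5) and Thm. 5.13 (TeX `main.tex`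
L2238–2271; held text `paper:arxiv-1511.02927` p0020). THEOREMS ONLY; sibling of the statement file
`BI17FundamentalInvariantTensors.lean` (val-lit row BI2017-B), whose `fundInvariantTensor n k` is
`F_n(w) = ∑_{α,β,γ : [n]³ → [n²]} sgn_x(α) sgn_y(β) sgn_z(γ) ∏_{p ∈ [n]³} w_{α(p)β(p)γ(p)}` (5.5).

* `aeval_fundInvariantTensor_actTensor` — **Thm. 5.13, first sentence, PROVED** (for arbitrary
  square matrices `g₁, g₂, g₃`, invertible or not):
  `F_n((g₁ ⊗ g₂ ⊗ g₃)w) = (det(g₁)det(g₂)det(g₃))^n F_n(w)`. The printed proof is "rather indirect"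
  (Schur–Weyl duality and `k_{n²}(n) = 1`); here the identity is proved directly from (5.5): summing
  over the labeling `α` alone, slice by slice, `∑_α sgn_x(α) ∏_p w_{α(p)β(p)γ(p)} =
  ∏_{ℓ} det(M_ℓ)` with the `n² × n²` matrices `M_ℓ[a,q] = w_{a β(ℓ,q) γ(ℓ,q)}` (`q` running over
  the `ℓ`-th `x`-slice), and `(g₁ ⊗ 1 ⊗ 1)` replaces `M_ℓ` by `g₁ M_ℓ`
  (`sum_sliceSign_mul_prod_eq_prod_det`); likewise for `β` (y-slices, `g₂`) and `γ` (z-slices, `g₃`).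
* Consequences: `fundInvariantTensor_tensorChi_pow` (the `GL³` form with BI's character `χ`),
  `isSL3Invariant_fundInvariantTensor` (`F_n ∈ O(⊗³ℂ^{n²})^{SL³}`),
  `fundInvariantTensor_isHomogeneous` (degree `n³`), `fundInvariantTensor_mem_sl3InvariantsOfDegree`,
  and the reduction `BI2017_thm_5_13_of_ne_zero`: the named fact `BI2017_thm_5_13` now rests on its
  second sentence "`F_n ≠ 0`" alone (printed proof: `k_{n²}(n) = 1`, Thm. 5.9(3); not proved here),
  as does `cube_mem_genericTensorDegreeMonoid_of_ne_zero` (`n³ ∈ E(n²)`).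

Honest framing: typed-literature proofs for the cell `val-lit`; nothing here bears on VP versus VNP.

## References

* [BurgisserIkenmeyer2017] P. Bürgisser, C. Ikenmeyer, *Fundamental invariants of orbit closures*,
  J. Algebra 477 (2017) 390–434; arXiv:1511.02927, §5.1 eq. (5.5), Thm. 5.13.
* P. Bürgisser, C. Ikenmeyer, *Explicit lower bounds via geometric complexity theory*, STOC 2013,
  Ex. 4.12 (the obstruction design behind `F_n`).
-/

noncomputable section

open MvPolynomial Matrix

namespace Literature.Computability.AlgebraicComplexity

/-! ### Step 1: expansion of `F_n(w)` and one-leg actions -/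

section Expansion

variable (n : ℕ)

/-- `F_n(w) = ∑_{α,β,γ} sgn_x(α) sgn_y(β) sgn_z(γ) ∏_p w_{α(p)β(p)γ(p)}` (eq. (5.5) evaluated).
[cite: BurgisserIkenmeyer2017, §5.1 eq. (5.5)] -/
theorem aeval_fundInvariantTensor (w : Fin (n * n) → Fin (n * n) → Fin (n * n) → ℂ) :
    aeval (tensorPt w) (fundInvariantTensor n ℂ) =
      ∑ α : Fin n × Fin n × Fin n → Fin (n * n), ∑ β : Fin n × Fin n × Fin n → Fin (n * n),
        ∑ γ : Fin n × Fin n × Fin n → Fin (n * n),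
          ((labelSignX n α * labelSignY n β * labelSignZ n γ : ℤ) : ℂ) *
            ∏ p : Fin n × Fin n × Fin n, w (α p) (β p) (γ p) := by
  simp only [fundInvariantTensor, map_sum, map_mul, map_prod, MvPolynomial.aeval_X, tensorPt,
    map_intCast]

variable {ι : Type*} [Fintype ι] [DecidableEq ι]

/-- `((G ⊗ 1 ⊗ 1)w)_{abc} = ∑_{a'} G_{aa'} w_{a'bc}`. [folklore] -/
private theorem actTensor_fst_one_one_apply (G : Matrix ι ι ℂ) (w : ι → ι → ι → ℂ) (a b c : ι) :
    actTensor G (1 : Matrix ι ι ℂ) (1 : Matrix ι ι ℂ) w a b c = ∑ a', G a a' * w a' b c := by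
  simp only [actTensor_apply, Matrix.one_apply, mul_ite, mul_one, mul_zero, ite_mul, zero_mul,
    Finset.sum_ite_eq, Finset.mem_univ, if_true]

/-- `((1 ⊗ G ⊗ 1)w)_{abc} = ∑_{b'} G_{bb'} w_{ab'c}`. [folklore] -/
private theorem actTensor_one_snd_one_apply (G : Matrix ι ι ℂ) (w : ι → ι → ι → ℂ) (a b c : ι) :
    actTensor (1 : Matrix ι ι ℂ) G (1 : Matrix ι ι ℂ) w a b c = ∑ b', G b b' * w a b' c := by
  simp only [actTensor_apply, Matrix.one_apply, mul_ite, mul_one, mul_zero, ite_mul, zero_mul,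
    one_mul, Finset.sum_ite_irrel, Finset.sum_const_zero, Finset.sum_ite_eq, Finset.mem_univ,
    if_true]

/-- `((1 ⊗ 1 ⊗ G)w)_{abc} = ∑_{c'} G_{cc'} w_{abc'}`. [folklore] -/
private theorem actTensor_one_one_thd_apply (G : Matrix ι ι ℂ) (w : ι → ι → ι → ℂ) (a b c : ι) :
    actTensor (1 : Matrix ι ι ℂ) (1 : Matrix ι ι ℂ) G w a b c = ∑ c', G c c' * w a b c' := by
  simp only [actTensor_apply, Matrix.one_apply, mul_ite, mul_one, mul_zero, ite_mul, zero_mul,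
    one_mul, Finset.sum_ite_irrel, Finset.sum_const_zero, Finset.sum_ite_eq, Finset.mem_univ,
    if_true]

end Expansion

/-! ### Step 2: summing over one labeling slice by slice gives a product of determinants -/

section Slices

variable {n : ℕ}

/-- `sgn` of a family of slices as the product of the individual (zero-extended) signs. [folklore] -/
private theorem cast_sliceSign_eq_prod (s : Fin n → Fin (n * n) → Fin (n * n)) :
    (sliceSign n s : ℂ) = ∏ ℓ, (if Function.Bijective (s ℓ) then
      (((Kumar2015.seqSign (s ℓ) : ℤˣ) : ℤ) : ℂ) else 0) := by
  classical
  unfold sliceSign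
  by_cases h : ∀ ℓ, Function.Bijective (s ℓ)
  · rw [if_pos h, Int.cast_prod]
    exact Finset.prod_congr rfl fun ℓ _ => (if_pos (h ℓ)).symm
  · rw [if_neg h, Int.cast_zero]
    push Not at h
    obtain ⟨ℓ, hℓ⟩ := h
    exact (Finset.prod_eq_zero (Finset.mem_univ ℓ) (if_neg hℓ)).symm

/-- The Leibniz expansion over all MAPS `[N] → [N]`, non-bijective ones weighted `0`:
`∑_f sgn(f) ∏_q V[f(q), q] = det V`. [folklore] -/
private theorem sum_ite_bijective_mul_prod_eq_det {N : ℕ} (V : Matrix (Fin N) (Fin N) ℂ) :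
    ∑ f : Fin N → Fin N, (if Function.Bijective f then
        (((Kumar2015.seqSign f : ℤˣ) : ℤ) : ℂ) else 0) * ∏ q, V (f q) q = V.det := by
  classical
  rw [Matrix.det_apply']
  have himage : (Finset.univ : Finset (Fin N → Fin N)).filter Function.Bijective =
      Finset.univ.image fun σ : Equiv.Perm (Fin N) => (σ : Fin N → Fin N) := by
    ext f
    simp only [Finset.mem_filter, Finset.mem_univ, true_and, Finset.mem_image]
    exact ⟨fun hf => ⟨Equiv.ofBijective f hf, rfl⟩, fun ⟨σ, hσ⟩ => hσ ▸ σ.bijective⟩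
  have h1 : ∑ f : Fin N → Fin N, (if Function.Bijective f then
        (((Kumar2015.seqSign f : ℤˣ) : ℤ) : ℂ) else 0) * ∏ q, V (f q) q =
      ∑ f ∈ (Finset.univ : Finset (Fin N → Fin N)).filter Function.Bijective,
        (if Function.Bijective f then (((Kumar2015.seqSign f : ℤˣ) : ℤ) : ℂ) else 0) *
          ∏ q, V (f q) q := by
    refine (Finset.sum_subset (Finset.filter_subset _ _) fun f _ hf => ?_).symm
    have hf' : ¬ Function.Bijective f := fun h =>
      hf (Finset.mem_filter.mpr ⟨Finset.mem_univ _, h⟩)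
    rw [if_neg hf', zero_mul]
  rw [h1, himage, Finset.sum_image fun σ _ τ _ h => Equiv.ext (congrFun h)]
  refine Finset.sum_congr rfl fun σ _ => ?_
  rw [if_pos σ.bijective, Kumar2015.seqSign_coe_perm]

/-- **Slice-by-slice determinant expansion.** For a slicing `e : [n]³ ≃ [n] × [n²]` of the cube
(slice index, position in the slice, `sl ℓ q = e⁻¹(ℓ,q)`) and any weights `v_p(a)`:
`∑_{α : [n]³ → [n²]} sgn(α) ∏_p v_p(α(p)) = ∏_ℓ det [v_{sl ℓ q}(a)]_{a,q}`, where `sgn(α)` is the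
product of the signs of `α` on the slices (`0` if `α` is not bijective on some slice).
[cite: BurgisserIkenmeyer2017, Thm. 5.13 (proof, reorganised)] -/
theorem sum_sliceSign_mul_prod_eq_prod_det (e : Fin n × Fin n × Fin n ≃ Fin n × Fin (n * n))
    (sl : Fin n → Fin (n * n) → Fin n × Fin n × Fin n) (hsl : ∀ ℓ q, e.symm (ℓ, q) = sl ℓ q)
    (v : Fin n × Fin n × Fin n → Fin (n * n) → ℂ) :
    ∑ α : Fin n × Fin n × Fin n → Fin (n * n),
        (sliceSign n (fun ℓ q => α (sl ℓ q)) : ℂ) * ∏ p, v p (α p) =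
      ∏ ℓ, (Matrix.of fun a q => v (sl ℓ q) a).det := by
  classical
  -- reindex the labelings by their families of slice maps
  have step1 : ∑ α : Fin n × Fin n × Fin n → Fin (n * n),
        (sliceSign n (fun ℓ q => α (sl ℓ q)) : ℂ) * ∏ p, v p (α p) =
      ∑ s : Fin n → Fin (n * n) → Fin (n * n),
        (sliceSign n s : ℂ) * ∏ ℓ, ∏ q, v (sl ℓ q) (s ℓ q) := by
    refine Fintype.sum_equiv ((Equiv.arrowCongr e (Equiv.refl _)).trans (Equiv.curry _ _ _)) _ _
      fun α => ?_
    have hE : ((Equiv.arrowCongr e (Equiv.refl _)).trans (Equiv.curry _ _ _)) α =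
        fun ℓ q => α (sl ℓ q) := by
      funext ℓ q
      simp [Equiv.arrowCongr_apply, Function.curry, hsl]
    rw [hE, ← e.symm.prod_comp fun p => v p (α p), Fintype.prod_prod_type]
    simp only [hsl]
  rw [step1]
  -- split the sign and regroup slice by slice
  have step2 : ∀ s : Fin n → Fin (n * n) → Fin (n * n),
      (sliceSign n s : ℂ) * ∏ ℓ, ∏ q, v (sl ℓ q) (s ℓ q) =
        ∏ ℓ, ((if Function.Bijective (s ℓ) then
          (((Kumar2015.seqSign (s ℓ) : ℤˣ) : ℤ) : ℂ) else 0) * ∏ q, v (sl ℓ q) (s ℓ q)) := by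
    intro s
    rw [cast_sliceSign_eq_prod, Finset.prod_mul_distrib]
  simp_rw [step2]
  have step3 := Finset.sum_prod_piFinset (Finset.univ : Finset (Fin (n * n) → Fin (n * n)))
    fun ℓ (f : Fin (n * n) → Fin (n * n)) =>
      (if Function.Bijective f then (((Kumar2015.seqSign f : ℤˣ) : ℤ) : ℂ) else 0) *
        ∏ q, v (sl ℓ q) (f q)
  rw [Fintype.piFinset_univ] at step3
  rw [step3]
  refine Finset.prod_congr rfl fun ℓ _ => ?_
  rw [← sum_ite_bijective_mul_prod_eq_det]
  simp only [Matrix.of_apply]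

end Slices

/-! ### Step 3: the three legs -/

section Legs

variable (n : ℕ)

/-- The `x`-slicing `(ℓ,(j,k)) ↦ (ℓ, jk)` matches `xSliceMap`. [folklore] -/
private theorem exists_xSlicing : ∃ e : Fin n × Fin n × Fin n ≃ Fin n × Fin (n * n),
    ∀ ℓ q, e.symm (ℓ, q) = (ℓ, finProdFinEquiv.symm q) :=
  ⟨Equiv.prodCongr (Equiv.refl _) finProdFinEquiv, fun _ _ => rfl⟩

/-- The `y`-slicing `(i,ℓ,k) ↦ (ℓ, ik)` matches `ySliceMap`. [folklore] -/
private theorem exists_ySlicing : ∃ e : Fin n × Fin n × Fin n ≃ Fin n × Fin (n * n),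
    ∀ ℓ q, e.symm (ℓ, q) = ((finProdFinEquiv.symm q).1, ℓ, (finProdFinEquiv.symm q).2) :=
  ⟨{ toFun := fun p => (p.2.1, finProdFinEquiv (p.1, p.2.2))
     invFun := fun r => ((finProdFinEquiv.symm r.2).1, r.1, (finProdFinEquiv.symm r.2).2)
     left_inv := fun p => by simp only [Equiv.symm_apply_apply]
     right_inv := fun r => by simp only [Prod.mk.eta, Equiv.apply_symm_apply] }, fun _ _ => rfl⟩

/-- The `z`-slicing `(i,j,ℓ) ↦ (ℓ, ij)` matches `zSliceMap`. [folklore] -/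
private theorem exists_zSlicing : ∃ e : Fin n × Fin n × Fin n ≃ Fin n × Fin (n * n),
    ∀ ℓ q, e.symm (ℓ, q) = ((finProdFinEquiv.symm q).1, (finProdFinEquiv.symm q).2, ℓ) :=
  ⟨{ toFun := fun p => (p.2.2, finProdFinEquiv (p.1, p.2.1))
     invFun := fun r => ((finProdFinEquiv.symm r.2).1, (finProdFinEquiv.symm r.2).2, r.1)
     left_inv := fun p => by simp only [Equiv.symm_apply_apply]
     right_inv := fun r => by simp only [Prod.mk.eta, Equiv.apply_symm_apply] }, fun _ _ => rfl⟩

/-- Reordering `∑_α ∑_β ∑_γ` with `β` innermost. [folklore] -/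
private theorem sum3_comm_mid {α M : Type*} [Fintype α] [AddCommMonoid M] (f : α → α → α → M) :
    ∑ a, ∑ b, ∑ c, f a b c = ∑ a, ∑ c, ∑ b, f a b c :=
  Finset.sum_congr rfl fun _ _ => Finset.sum_comm

/-- Reordering `∑_α ∑_β ∑_γ` with `α` innermost. [folklore] -/
private theorem sum3_comm_first {α M : Type*} [Fintype α] [AddCommMonoid M] (f : α → α → α → M) :
    ∑ a, ∑ b, ∑ c, f a b c = ∑ b, ∑ c, ∑ a, f a b c := by
  rw [Finset.sum_comm]
  exact Finset.sum_congr rfl fun _ _ => Finset.sum_comm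

/-- **Leg 1.** `F_n((G ⊗ 1 ⊗ 1)w) = det(G)^n F_n(w)`: `F_n(w) = ∑_{β,γ} sgn_y(β) sgn_z(γ)
∏_ℓ det(M_ℓ)`, `M_ℓ[a,(j,k)] = w_{a β(ℓ,j,k) γ(ℓ,j,k)}`, and `G` acts by `M_ℓ ↦ G M_ℓ`.
[cite: BurgisserIkenmeyer2017, Thm. 5.13] -/
theorem aeval_fundInvariantTensor_actTensor_fst (G : Matrix (Fin (n * n)) (Fin (n * n)) ℂ)
    (w : Fin (n * n) → Fin (n * n) → Fin (n * n) → ℂ) :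
    aeval (tensorPt (actTensor G 1 1 w)) (fundInvariantTensor n ℂ) =
      G.det ^ n * aeval (tensorPt w) (fundInvariantTensor n ℂ) := by
  classical
  obtain ⟨e, he⟩ := exists_xSlicing n
  -- `F_n(u) = ∑_{β,γ} sgn_y sgn_z ∏_ℓ det`, for every tensor `u`
  have hF : ∀ u : Fin (n * n) → Fin (n * n) → Fin (n * n) → ℂ,
      aeval (tensorPt u) (fundInvariantTensor n ℂ) =
        ∑ β : Fin n × Fin n × Fin n → Fin (n * n), ∑ γ : Fin n × Fin n × Fin n → Fin (n * n),
          ((labelSignY n β * labelSignZ n γ : ℤ) : ℂ) *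
            ∏ ℓ, (Matrix.of fun a q =>
              u a (β (ℓ, finProdFinEquiv.symm q)) (γ (ℓ, finProdFinEquiv.symm q))).det := by
    intro u
    rw [aeval_fundInvariantTensor, sum3_comm_first]
    refine Finset.sum_congr rfl fun β _ => Finset.sum_congr rfl fun γ _ => ?_
    rw [← sum_sliceSign_mul_prod_eq_prod_det e _ he fun p a => u a (β p) (γ p), Finset.mul_sum]
    refine Finset.sum_congr rfl fun α _ => ?_
    have hx : labelSignX n α = sliceSign n (fun ℓ q => α (ℓ, finProdFinEquiv.symm q)) := rfl
    rw [hx]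
    push_cast
    ring
  rw [hF, hF w, Finset.mul_sum]
  refine Finset.sum_congr rfl fun β _ => ?_
  rw [Finset.mul_sum]
  refine Finset.sum_congr rfl fun γ _ => ?_
  have hmat : ∀ ℓ : Fin n,
      (Matrix.of fun a q => actTensor G 1 1 w a (β (ℓ, finProdFinEquiv.symm q))
          (γ (ℓ, finProdFinEquiv.symm q))) =
        G * Matrix.of fun a q => w a (β (ℓ, finProdFinEquiv.symm q))
          (γ (ℓ, finProdFinEquiv.symm q)) := by
    intro ℓ
    ext a q
    simp only [Matrix.of_apply, Matrix.mul_apply, actTensor_fst_one_one_apply]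
  simp_rw [hmat, Matrix.det_mul, Finset.prod_mul_distrib, Finset.prod_const, Finset.card_univ,
    Fintype.card_fin]
  ring

/-- **Leg 2.** `F_n((1 ⊗ G ⊗ 1)w) = det(G)^n F_n(w)` (y-slices).
[cite: BurgisserIkenmeyer2017, Thm. 5.13] -/
theorem aeval_fundInvariantTensor_actTensor_snd (G : Matrix (Fin (n * n)) (Fin (n * n)) ℂ)
    (w : Fin (n * n) → Fin (n * n) → Fin (n * n) → ℂ) :
    aeval (tensorPt (actTensor 1 G 1 w)) (fundInvariantTensor n ℂ) =
      G.det ^ n * aeval (tensorPt w) (fundInvariantTensor n ℂ) := by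
  classical
  obtain ⟨e, he⟩ := exists_ySlicing n
  have hF : ∀ u : Fin (n * n) → Fin (n * n) → Fin (n * n) → ℂ,
      aeval (tensorPt u) (fundInvariantTensor n ℂ) =
        ∑ α : Fin n × Fin n × Fin n → Fin (n * n), ∑ γ : Fin n × Fin n × Fin n → Fin (n * n),
          ((labelSignX n α * labelSignZ n γ : ℤ) : ℂ) *
            ∏ ℓ, (Matrix.of fun b q =>
              u (α ((finProdFinEquiv.symm q).1, ℓ, (finProdFinEquiv.symm q).2)) b
                (γ ((finProdFinEquiv.symm q).1, ℓ, (finProdFinEquiv.symm q).2))).det := by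
    intro u
    rw [aeval_fundInvariantTensor, sum3_comm_mid]
    refine Finset.sum_congr rfl fun α _ => Finset.sum_congr rfl fun γ _ => ?_
    rw [← sum_sliceSign_mul_prod_eq_prod_det e _ he fun p b => u (α p) b (γ p), Finset.mul_sum]
    refine Finset.sum_congr rfl fun β _ => ?_
    have hy : labelSignY n β = sliceSign n
        (fun ℓ q => β ((finProdFinEquiv.symm q).1, ℓ, (finProdFinEquiv.symm q).2)) := rfl
    rw [hy]
    push_cast
    ring
  rw [hF, hF w, Finset.mul_sum]
  refine Finset.sum_congr rfl fun α _ => ?_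
  rw [Finset.mul_sum]
  refine Finset.sum_congr rfl fun γ _ => ?_
  have hmat : ∀ ℓ : Fin n,
      (Matrix.of fun b q =>
          actTensor 1 G 1 w (α ((finProdFinEquiv.symm q).1, ℓ, (finProdFinEquiv.symm q).2)) b
            (γ ((finProdFinEquiv.symm q).1, ℓ, (finProdFinEquiv.symm q).2))) =
        G * Matrix.of fun b q =>
          w (α ((finProdFinEquiv.symm q).1, ℓ, (finProdFinEquiv.symm q).2)) b
            (γ ((finProdFinEquiv.symm q).1, ℓ, (finProdFinEquiv.symm q).2)) := by
    intro ℓ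
    ext b q
    simp only [Matrix.of_apply, Matrix.mul_apply, actTensor_one_snd_one_apply]
  simp_rw [hmat, Matrix.det_mul, Finset.prod_mul_distrib, Finset.prod_const, Finset.card_univ,
    Fintype.card_fin]
  ring

/-- **Leg 3.** `F_n((1 ⊗ 1 ⊗ G)w) = det(G)^n F_n(w)` (z-slices).
[cite: BurgisserIkenmeyer2017, Thm. 5.13] -/
theorem aeval_fundInvariantTensor_actTensor_thd (G : Matrix (Fin (n * n)) (Fin (n * n)) ℂ)
    (w : Fin (n * n) → Fin (n * n) → Fin (n * n) → ℂ) :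
    aeval (tensorPt (actTensor 1 1 G w)) (fundInvariantTensor n ℂ) =
      G.det ^ n * aeval (tensorPt w) (fundInvariantTensor n ℂ) := by
  classical
  obtain ⟨e, he⟩ := exists_zSlicing n
  have hF : ∀ u : Fin (n * n) → Fin (n * n) → Fin (n * n) → ℂ,
      aeval (tensorPt u) (fundInvariantTensor n ℂ) =
        ∑ α : Fin n × Fin n × Fin n → Fin (n * n), ∑ β : Fin n × Fin n × Fin n → Fin (n * n),
          ((labelSignX n α * labelSignY n β : ℤ) : ℂ) *
            ∏ ℓ, (Matrix.of fun c q =>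
              u (α ((finProdFinEquiv.symm q).1, (finProdFinEquiv.symm q).2, ℓ))
                (β ((finProdFinEquiv.symm q).1, (finProdFinEquiv.symm q).2, ℓ)) c).det := by
    intro u
    rw [aeval_fundInvariantTensor]
    refine Finset.sum_congr rfl fun α _ => Finset.sum_congr rfl fun β _ => ?_
    rw [← sum_sliceSign_mul_prod_eq_prod_det e _ he fun p c => u (α p) (β p) c, Finset.mul_sum]
    refine Finset.sum_congr rfl fun γ _ => ?_
    have hz : labelSignZ n γ = sliceSign n
        (fun ℓ q => γ ((finProdFinEquiv.symm q).1, (finProdFinEquiv.symm q).2, ℓ)) := rfl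
    rw [hz]
    push_cast
    ring
  rw [hF, hF w, Finset.mul_sum]
  refine Finset.sum_congr rfl fun α _ => ?_
  rw [Finset.mul_sum]
  refine Finset.sum_congr rfl fun β _ => ?_
  have hmat : ∀ ℓ : Fin n,
      (Matrix.of fun c q =>
          actTensor 1 1 G w (α ((finProdFinEquiv.symm q).1, (finProdFinEquiv.symm q).2, ℓ))
            (β ((finProdFinEquiv.symm q).1, (finProdFinEquiv.symm q).2, ℓ)) c) =
        G * Matrix.of fun c q =>
          w (α ((finProdFinEquiv.symm q).1, (finProdFinEquiv.symm q).2, ℓ))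
            (β ((finProdFinEquiv.symm q).1, (finProdFinEquiv.symm q).2, ℓ)) c := by
    intro ℓ
    ext c q
    simp only [Matrix.of_apply, Matrix.mul_apply, actTensor_one_one_thd_apply]
  simp_rw [hmat, Matrix.det_mul, Finset.prod_mul_distrib, Finset.prod_const, Finset.card_univ,
    Fintype.card_fin]
  ring

end Legs

/-! ### Step 4: Theorem 5.13 (first sentence) and consequences -/

/-- **BI 2017, Thm. 5.13, first sentence — PROVED** (for arbitrary square matrices):
`F_n((g₁ ⊗ g₂ ⊗ g₃)w) = (det(g₁)det(g₂)det(g₃))^n F_n(w)`. [cite: BurgisserIkenmeyer2017, Thm. 5.13] -/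
theorem aeval_fundInvariantTensor_actTensor (n : ℕ) (G₁ G₂ G₃ : Matrix (Fin (n * n)) (Fin (n * n)) ℂ)
    (w : Fin (n * n) → Fin (n * n) → Fin (n * n) → ℂ) :
    aeval (tensorPt (actTensor G₁ G₂ G₃ w)) (fundInvariantTensor n ℂ) =
      (G₁.det * G₂.det * G₃.det) ^ n * aeval (tensorPt w) (fundInvariantTensor n ℂ) := by
  have h : actTensor G₁ G₂ G₃ w =
      actTensor G₁ (1 : Matrix (Fin (n * n)) (Fin (n * n)) ℂ) (1 : Matrix (Fin (n * n)) (Fin (n * n)) ℂ)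
        (actTensor (1 : Matrix (Fin (n * n)) (Fin (n * n)) ℂ) G₂ (1 : Matrix (Fin (n * n)) (Fin (n * n)) ℂ)
          (actTensor (1 : Matrix (Fin (n * n)) (Fin (n * n)) ℂ) (1 : Matrix (Fin (n * n)) (Fin (n * n)) ℂ)
            G₃ w)) := by
    rw [actTensor_actTensor, actTensor_actTensor]
    simp only [Matrix.mul_one, Matrix.one_mul]
  rw [h, aeval_fundInvariantTensor_actTensor_fst, aeval_fundInvariantTensor_actTensor_snd,
    aeval_fundInvariantTensor_actTensor_thd]
  ring

/-- **BI 2017, Thm. 5.13, first sentence, in the letters of the named fact**: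
`F_n((g₁ ⊗ g₂ ⊗ g₃)w) = χ(g)^n F_n(w)` for `g ∈ GL³_{n²}`, `χ(g) = det g₁ det g₂ det g₃`.
[cite: BurgisserIkenmeyer2017, Thm. 5.13] -/
theorem fundInvariantTensor_tensorChi_pow (n : ℕ)
    (g : GL (Fin (n * n)) ℂ × GL (Fin (n * n)) ℂ × GL (Fin (n * n)) ℂ)
    (w : Fin (n * n) → Fin (n * n) → Fin (n * n) → ℂ) :
    aeval (tensorPt (actTensor (g.1 : Matrix (Fin (n * n)) (Fin (n * n)) ℂ)
        (g.2.1 : Matrix (Fin (n * n)) (Fin (n * n)) ℂ) (g.2.2 : Matrix (Fin (n * n)) (Fin (n * n)) ℂ)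
        w)) (fundInvariantTensor n ℂ) =
      ((tensorChi g : ℂˣ) : ℂ) ^ n * aeval (tensorPt w) (fundInvariantTensor n ℂ) := by
  rw [aeval_fundInvariantTensor_actTensor]
  simp only [tensorChi, Units.val_mul, Matrix.GeneralLinearGroup.val_det_apply]

/-- **`F_n` is an `SL³`-invariant** (`F_n ∈ O(⊗³ℂ^{n²})^{SL³_{n²}}`, the setting of Def. 5.7 /
Thm. 5.11). [cite: BurgisserIkenmeyer2017, Thm. 5.13] -/
theorem isSL3Invariant_fundInvariantTensor (n : ℕ) : IsSL3Invariant (fundInvariantTensor n ℂ) := by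
  intro g₁ g₂ g₃ w
  rw [aeval_fundInvariantTensor_actTensor, g₁.det_coe, g₂.det_coe, g₃.det_coe, mul_one, mul_one,
    one_pow, one_mul]

/-- `F_n` is homogeneous of degree `n³` ("homogeneous polynomial of degree `n³`", L2256).
[cite: BurgisserIkenmeyer2017, §5.1 eq. (5.5)] -/
theorem fundInvariantTensor_isHomogeneous (n : ℕ) (k : Type*) [Field k] :
    (fundInvariantTensor n k).IsHomogeneous (n ^ 3) := by
  have hcard : Fintype.card (Fin n × Fin n × Fin n) = n ^ 3 := by
    simp only [Fintype.card_prod, Fintype.card_fin]; ring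
  unfold fundInvariantTensor
  refine IsHomogeneous.sum _ _ _ fun α _ => IsHomogeneous.sum _ _ _ fun β _ =>
    IsHomogeneous.sum _ _ _ fun γ _ => ?_
  have hprod : (∏ p : Fin n × Fin n × Fin n, (X (α p, β p, γ p) :
      MvPolynomial (Fin (n * n) × Fin (n * n) × Fin (n * n)) k)).IsHomogeneous
        (∑ p : Fin n × Fin n × Fin n, 1) :=
    IsHomogeneous.prod _ _ _ fun p _ => isHomogeneous_X k _
  rw [Finset.sum_const, smul_eq_mul, mul_one, Finset.card_univ, hcard] at hprod
  simpa only [zero_add] using (isHomogeneous_C _ _).mul hprod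

/-- `F_n ∈ O(⊗³ℂ^{n²})^{SL³}_{n³}` (the degree-`n³` invariants, eq. (5.1)).
[cite: BurgisserIkenmeyer2017, §5 eq. (5.1) and Thm. 5.13] -/
theorem fundInvariantTensor_mem_sl3InvariantsOfDegree (n : ℕ) :
    fundInvariantTensor n ℂ ∈ sl3InvariantsOfDegree (Fin (n * n)) ℂ (n ^ 3) :=
  (mem_sl3InvariantsOfDegree_iff _ _).mpr
    ⟨fundInvariantTensor_isHomogeneous n ℂ, isSL3Invariant_fundInvariantTensor n⟩

/-- Granted the second sentence "`F_n ≠ 0`" of Thm. 5.13, `n³` lies in the generic degree monoid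
`E(n²)` of eq. (5.1) (the upper bound `e'(n²) ≤ n` of Thm. 5.9(3)).
[cite: BurgisserIkenmeyer2017, Thm. 5.9 (3) and Thm. 5.13] -/
theorem cube_mem_genericTensorDegreeMonoid_of_ne_zero (n : ℕ) (h : fundInvariantTensor n ℂ ≠ 0) :
    n ^ 3 ∈ genericTensorDegreeMonoid (Fin (n * n)) ℂ :=
  ⟨fundInvariantTensor n ℂ, fundInvariantTensor_isHomogeneous n ℂ,
    isSL3Invariant_fundInvariantTensor n, h⟩

/-- **Reduction of the named fact `BI2017_thm_5_13` to its second sentence**: with the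
semi-invariance PROVED, Thm. 5.13 as typed follows from "`F_n ≠ 0` for `n ≥ 1`" alone (printed
proof of that clause: Schur–Weyl duality and `k_{n²}(n) = 1`, Thm. 5.9(3); not proved in the tree).
[cite: BurgisserIkenmeyer2017, Thm. 5.13] -/
theorem BI2017_thm_5_13_of_ne_zero (h : ∀ n : ℕ, 1 ≤ n → fundInvariantTensor n ℂ ≠ 0) :
    BI2017_thm_5_13 := fun n hn =>
  ⟨fun g w => fundInvariantTensor_tensorChi_pow n g w, h n hn⟩

end Literature.Computability.AlgebraicComplexity
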